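import Summits.BirchSwinnertonDyer.BirchSwinnertonDyer.Theorems.CMKolyvaginAtInertTwoLevelZeroPrimeHeegnerBSDTwoOfPrintedInputs
import Summits.BirchSwinnertonDyer.Rank1Residual.P2.CMKolyvaginRationalDescentPlumbingAtTwo
import Summits.BirchSwinnertonDyer.Rank1Residual.X11b.KolyvaginLeafInputsDischarged
import HarnessLib

/-!
# Route `CMKolyvaginAtInertTwo`, crux `CMKolyvaginExactAtInertTwo` (stmt-BirchSwinnertonDyer-24277):
# THE H₂ LEVEL-ZERO CLASS THEOREM, PRINT ONLY — `BSD₂(E)` for every `E ∈ H₂` with a prime Heegner field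
# and a `2`-indivisible `y_K`, from named facts and printed statements; no other hypothesis displayed

Seat `bsd-line-cmk2-p1` g9 (cell `bsd-print-cf2`); helper (`--supports stmt-BirchSwinnertonDyer-24277`).
THEOREMS ONLY (no definition, no named fact, no instance, no `sorry`); no item is closed; BSD is not
proved by this.

`CMLevelZeroTwo.bsdp_two_of_levelZero_primeHeegner_of_printedInputs_of_plumbing` (this seat) with its two
PLUMBING binders DISCHARGED by ty2 g22's theorems (`Rank1Residual.P2.RationalDescentPlumbing.htower_two_pow_one`,
`hdescfin_two_pow_one`, p636109) and the auxiliary place `u` of `q` eliminated. This is the theorem the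
pen's booking memo `BOOKING-TARGET-H2-levelzero.md` v2 (§§2, 5; booking rule (c)) asks for: the level-zero
(`M₀ = 0`) sub-class of H₂ with a PRIME Heegner field, `BSD₂` from PRINTS + THEOREMS only. Displayed inputs,
all print: the five BSD-side named facts (modularity `exists_isNewformOf`, Gross–Zagier `gross_zagier` at
every level, Gross–Zagier–Kolyvagin `rank_eq_analyticRank_of_analyticRank_le_one`, Milne 1972 any-model,
Burungale–Flach `bsdTriple_of_hasCM_of_L_one_ne_zero`), the named fact
`GrossLMS1991.prop37_2_reductionCongruence_inert N_E W K` (Gross 1991 Prop. 3.7 (2)), and ONE cite-only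
printed statement in the binder shape of the odd-`p` X11b road: `hGZ31` (Gross–Zagier 1986 III (3.1)); Gross
1991 Prop. 5.3 at conductor `m` (`h53`) is DISCHARGED by x11b3's `X11b.KolyvaginLeaves.h53_holds` (Shimura
reciprocity at conductor `m` on the tree's model of `X₀(N)`, Atkin–Lehner, Manin–Drinfeld). Everything else — the reciprocity law and Poitou–Tate, Čebotarev, Gross 3.7
(1), Lemma 4.3 at `2`, CM rationality, Shimura reciprocity at conductors 1 and `m`, Gross 5.3, Deuring, the Kolyvagin classes,
McCallum 4.4 at supersingular primes, the `τ`-part and the over-`ℚ` bit of the `2`-descent, the plumbing, the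
Selmer-to-`Ш` step, the twin and the exact descent — is a THEOREM of the tree (cells b2b-bsdres, bsd-cm K7t,
bsd-f1-sign2, bsd-stepL, bsd-schneider, bsd-cn100, the gross37 typers, and this cell's seats g0–g9, ty1, ty2).

* `bsdp_two_of_levelZero_primeHeegner_of_print` — PRINTS → for every `W ∈ H₂` (`HasCM`, `CMInert W 2`,
  `ρ̄_{W,2}` onto, `r_an(W) = 1`, odd Tamagawa product, globally minimal), every imaginary quadratic `K` with
  `d_K = −q`, `q` prime, `d_K` odd `≠ −3` and the Heegner hypothesis for `N_E`, the two Euler-system prints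
  for `W, K` (Gross 3.7 (2) by name, GZ III (3.1)), every frame `Dt` (lattice clause, `Odd Dt.c`), `β`, `ι`, `d₁` with `y_K` of infinite order and
  `y_K ∉ 2E(K[1])`: **`BSDp W 2`**.

HONEST FRAMING: conditional on the displayed prints only; no `sorry`; the STATEMENT (exact `2`-part of BSD
for CM rank-one curves at an inert `2`, level-zero prime-Heegner sub-class) has no printed counterpart
(Kolyvagin / McCallum / Cha / Matar–Nekovář take `p` odd; tree barrier `CMRankOneAtNonsplitTwo`) — the
referee decides the beyond-print label at booking. BSD is not proved by this; no summit statement and no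
item is closed by this file.

References: [GrossLMS1991] §1 (1.2), Prop. 2.1, Props. 3.7, 5.3, 5.4, 6.2, §10; [McCallumLMS1991] §§1–5;
[GrossZagier1986] I.6.3, III (3.1), V.§2; [BurungaleFlach2024] Thm. 1.1, Cor. 2; [Milne1972] Thm. 1;
[MilneADT2006] I Prop. 3.8, Thm. 4.10 (b); [Darmon2004] Thm. 3.6; [Lang1987] Ch. 13 §4 Thm. 12.
-/

-- single-conjunct summit: `Summit.BirchSwinnertonDyer.BirchSwinnertonDyer.…` repeats the name by design
set_option linter.dupNamespace false
set_option autoImplicit false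

noncomputable section

open scoped Classical
open WeierstrassCurve NumberField IsDedekindDomain
open Literature.NumberTheory.EllipticCurves Literature.NumberTheory.EllipticCurves.ModularForms
open Literature.NumberTheory.EllipticCurves.Rank1Residual
open Literature.NumberTheory.EllipticCurves.RingClassField
open Literature.NumberTheory.GaloisRepresentations
open Summit.BirchSwinnertonDyer.Rank1Residual.X11b
open Rat.HeightOneSpectrum (primesEquiv)

namespace Summit.BirchSwinnertonDyer.BirchSwinnertonDyer.Theorems.CMLevelZeroTwo

/-- **THE H₂ LEVEL-ZERO CLASS THEOREM, PRINT ONLY** (module docstring): the five BSD-side named facts,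
the named fact Gross 3.7 (2) and the printed statement Gross–Zagier III (3.1) imply `BSD₂(W)` for every `W ∈ H₂` with a prime Heegner field `K = ℚ(√−q)` and a
frame whose `y_K` has infinite order and is not `2`-divisible in `E(K[1])`.
[cite: GrossLMS1991, §1 (1.2), Prop. 2.1 with §10, Props. 3.7, 5.3, 5.4, 6.2] [cite: McCallumLMS1991, §1
Theorem, §2 Prop. 2.2, §4 Prop. 4.4, §5 Lemma 5.1] [cite: GrossZagier1986, Thm. I.6.3, III (3.1), V.§2]
[cite: BurungaleFlach2024, Thm. 1.1 and Cor. 2] [cite: Milne1972ArithmeticAV, §1 Thm. 1] -/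
theorem bsdp_two_of_levelZero_primeHeegner_of_print (hmod : exists_isNewformOf)
    (hGZall : ∀ (N : ℕ) [NeZero N] (W : WeierstrassCurve ℚ) (K : Type) [Field K] [NumberField K],
      gross_zagier N W K)
    (hGZK : rank_eq_analyticRank_of_analyticRank_le_one)
    (hMilne : Milne1972.bsdQuotient_baseChange_quadratic_anyModel)
    (hBF : bsdTriple_of_hasCM_of_L_one_ne_zero)
    (W : WeierstrassCurve ℚ) [W.IsElliptic] [W.IsGloballyMinimal] [NeZero (W.conductorNorm ℤ)]
    (hCM : W.HasCM) (hin : CMInert W 2) (hsurj : W.HasSurjectiveModNGaloisRep (2 : ℤ))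
    (hr : W.analyticRank = 1) (hT : Odd W.tamagawaProduct)
    (K : Type) [Field K] [NumberField K] (hK : IsImaginaryQuadratic K) (hodd : Odd (discr K))
    (h3 : discr K ≠ -3) (hH : SatisfiesHeegnerHypothesis (W.conductorNorm ℤ) K)
    {q : ℕ} (hq : q.Prime) (hd : discr K = -(q : ℤ))
    (h372 : GrossLMS1991.prop37_2_reductionCongruence_inert (W.conductorNorm ℤ) W K)
    (hGZ31 : ∀ [W.IsElliptic] (_hK : IsImaginaryQuadratic K) (_hH : SatisfiesHeegnerHypothesis (W.conductorNorm ℤ) K)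
      (Dt : ModularParametrizationData W (W.conductorNorm ℤ)) (β : ℤ) (ι : K →+* ℂ) {M : ℕ} (_hM : 1 ≤ M) {n : ℕ}
      (_hn : Squarefree n)
      (_hKol : ∀ q ∈ n.primeFactors, IsKolyvaginPrime (W.conductorNorm ℤ) W K 2 q ∧ FrobEqFrobInfty W K (2 ^ M) q)
      (d : (m : ℕ) → m ∣ n → KolyvaginHeegnerData Dt β ι m),
      ∃ n' : ℤ, IsCoprime ((2 ^ M : ℕ) : ℤ) n' ∧
        ∀ (m : ℕ) (hm : m ∣ n) (γ : ringClassField K ι m ≃ₐ[ℚ] ringClassField K ι m),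
          γ ∈ ringClassGal ι m → ∀ v : HeightOneSpectrum (𝓞 K),
            ¬ (W.baseChange K).HasGoodReductionAt v →
            n' • pointsMap (W.baseChange K) (v.adicCompletion K)
                ((d m hm).toGeomPoints (pointGalHom W (ringClassField K ι m) γ (d m hm).y)) ∈
              E0Receptacle (W.baseChange K) v ∧
            ∀ (ℓ : ℕ) (hℓ : ℓ ∈ m.primeFactors)
              (hle : ringClassField K ι (m / ℓ) ≤ ringClassField K ι m),
              n' • pointsMap (W.baseChange K) (v.adicCompletion K)
                  ((d m hm).toGeomPoints (pointGalHom W (ringClassField K ι m) γ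
                    (WeierstrassCurve.Affine.Point.map (W' := W)
                      ((RingClassField.inclusion ι hle).restrictScalars ℚ)
                      (d (m / ℓ)
                        ((Nat.div_dvd_of_dvd (Nat.dvd_of_mem_primeFactors hℓ)).trans hm)).y))) ∈
                E0Receptacle (W.baseChange K) v)
    (Dt : ModularParametrizationData W (W.conductorNorm ℤ))
    (hopt : ∀ z ∈ Dt.L.lattice, ∃ w ∈ periodLattice Dt.f, z = (Dt.c : ℂ) * w) (hc : Odd Dt.c)
    (β : ℤ) (ι : K →+* ℂ) (d₁ : KolyvaginHeegnerData Dt β ι 1) (hy : ¬ IsOfFinAddOrder d₁.derivedPoint)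
    (h2 : ¬ ∃ Q : (W.baseChange (ringClassField K ι 1)).toAffine.Point, (2 : ℤ) • Q = d₁.derivedPoint) :
    BSDp W 2 := by
  -- the place `u` of `ℚ` below `q`
  obtain ⟨u, hu⟩ : ∃ u : HeightOneSpectrum (𝓞 ℚ), ((primesEquiv u : Nat.Primes) : ℕ) = q :=
    ⟨primesEquiv.symm ⟨q, hq⟩, by rw [Equiv.apply_symm_apply]⟩
  exact bsdp_two_of_levelZero_primeHeegner_of_printedInputs_of_plumbing hmod hGZall hGZK hMilne hBF W
    hCM hin hsurj hr hT K hK hodd h3 hH hq hd u hu h372 (KolyvaginLeaves.h53_holds rfl 2) hGZ31 Dt hopt hc β ι d₁ hy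
    h2
    (Rank1Residual.P2.RationalDescentPlumbing.htower_two_pow_one W K)
    (Rank1Residual.P2.RationalDescentPlumbing.hdescfin_two_pow_one W hK hH hq hd u hu)

end Summit.BirchSwinnertonDyer.BirchSwinnertonDyer.Theorems.CMLevelZeroTwo

end
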